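import Literature.Computability.QuantumComplexity.SignedCubicForrelation
import Literature.Computability.QuantumComplexity.ForrelationMSubspaceDuality

/-!
# Frame lock for the dual ping-pong: `(V, V^⊥)` is a coupled pair of M-subspaces

Helper file for line `dual-pingpong-frame` of crux stmt-QuantumAdvantage-13932
(`SignedExactCubicForrelationNotPrBPP`, route `QuantumAdvantage/CubicForrelation`), stub `stub_frameLock`.

Write `P := V^⊥ = {y | ∀ v ∈ V, (-1)^{v·y} = 1}`. If `Φ(a,b) = ±1` and `V` is an M-subspace of `b`
(`0 ∈ V`, closed under `⊕`, `|V|² = 2ⁿ`, all second differences `D_u D_v b`, `u v ∈ V`, vanish), then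

* (i) `P` is an M-subspace of `a`: `0 ∈ P`, `P` is closed under `⊕`, `|P|² = 2ⁿ`, and all second
  differences of `a` along `P` vanish — the last from the M-subspace duality
  `DerivativeWalsh.dual_affine_on_perp_cosets` (`a` is affine on every coset `x + V^⊥`);
* (ii) all third differences `D_u D_v D_w b` with `u v ∈ V` (any `w`) vanish;
* (iii) all third differences `D_u D_v D_w a` with `u v ∈ P` (any `w`) vanish.

No degree hypothesis is used. Main statement: `stub_frameLock`; the Boolean/sign bookkeeping is
`xor_four_eq_false_of_signOf` and `d2_eq_false_of_affine`.

## References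
* [Carlet2020] C. Carlet, Boolean Functions for Cryptography and Coding Theory, CUP 2021, Prop. 54
  (M-subspaces), Prop. 77 (dual of a Maiorana–McFarland bent function).
-/

noncomputable section

set_option linter.dupNamespace false -- D-0017: single-problem summit ⇒ `QuantumAdvantage.QuantumAdvantage` by design

namespace Summit.QuantumAdvantage.QuantumAdvantage.Theorems.SignedExactCubicForrelationNotPrBPP

open Finset
open Literature.Computability.Complexity Literature.Computability.QuantumComplexity
open Literature.Computability.QuantumComplexity.BuzetChailloux (bxor zeroVec)

/-- Sign bookkeeping: if `(-1)^p (-1)^q (-1)^r (-1)^s = 1` then `p ⊕ q ⊕ r ⊕ s = 0`.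
Proof: the sixteen cases. [folklore] -/
theorem xor_four_eq_false_of_signOf {p q r s : Bool}
    (h : signOf p * signOf q * signOf r * signOf s = 1) : (p ^^ q ^^ r ^^ s) = false := by
  revert h
  cases p <;> cases q <;> cases r <;> cases s <;> norm_num [signOf]

/-- If `a` is affine on the coset `x + P` in the sign sense — some `r` has
`(-1)^{a(x ⊕ z)} (-1)^{z·r} = (-1)^{a x}` for `z = u, v, u ⊕ v` — then the second difference
`a x ⊕ a(x ⊕ u) ⊕ a(x ⊕ v) ⊕ a(x ⊕ u ⊕ v)` vanishes. Proof: multiply the three relations, use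
`(-1)^{(u⊕v)·r} = (-1)^{u·r} (-1)^{v·r}` and `(±1)² = 1`. [folklore] -/
theorem d2_eq_false_of_affine {n : ℕ} (a : (Fin n → Bool) → Bool) (x u v r : Fin n → Bool)
    (hu : signOf (a (bxor x u)) * twist u r = signOf (a x))
    (hv : signOf (a (bxor x v)) * twist v r = signOf (a x))
    (huv : signOf (a (bxor x (bxor u v))) * twist (bxor u v) r = signOf (a x)) :
    (a x ^^ a (bxor x u) ^^ a (bxor x v) ^^ a (bxor x (bxor u v))) = false := by
  apply xor_four_eq_false_of_signOf
  rw [DerivativeWalsh.twist_bxor_left] at huv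
  have htu := Simon.twist_mul_self u r
  have htv := Simon.twist_mul_self v r
  have hA := BuzetChailloux.signOf_sq (a x)
  have hB : signOf (a (bxor x u)) = signOf (a x) * twist u r := by
    rw [← hu, mul_assoc, htu, mul_one]
  have hC : signOf (a (bxor x v)) = signOf (a x) * twist v r := by
    rw [← hv, mul_assoc, htv, mul_one]
  have hD : signOf (a (bxor x (bxor u v))) = signOf (a x) * (twist u r * twist v r) := by
    rw [← huv, mul_assoc, mul_mul_mul_comm, htu, htv, mul_one, mul_one]
  calc signOf (a x) * signOf (a (bxor x u)) * signOf (a (bxor x v)) * signOf (a (bxor x (bxor u v)))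
      = (signOf (a x) ^ 2) ^ 2 * (twist u r * twist u r) * (twist v r * twist v r) := by
        rw [hB, hC, hD]; ring
    _ = 1 := by rw [hA, htu, htv]; norm_num

/-- **Frame lock.** Let `Φ(a,b) = ±1` and let `V` be an M-subspace of `b` (`0 ∈ V`, `V` closed under
`⊕`, `|V|² = 2ⁿ`, all second differences of `b` along `V` vanish); put `P := V^⊥`. Then
(i) `P` is an M-subspace of `a` (`0 ∈ P` and `⊕`-closure: `DerivativeWalsh.bxor_mem_perp`;
`|P|² = 2ⁿ`: `|P| = |V|` by `DerivativeWalsh.perp_perp_eq_of_sq`; vanishing second differences of `a`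
along `P`: for `u v ∈ P` and any `x`, `DerivativeWalsh.dual_affine_on_perp_cosets` at base point `x`
gives `r` with `(-1)^{a(x⊕z)} (-1)^{z·r} = (-1)^{a x}` for all `z ∈ P`, applied at `z = u, v, u ⊕ v` and
combined by `d2_eq_false_of_affine`); (ii) every third difference `D_u D_v D_w b` (`u v ∈ V`) is the xor
of the second differences `D_u D_v b` at `x` and at `x ⊕ w`, both `0`; (iii) likewise for `a` along `P`
by (i). This keeps the two-tensor ping-pong closure inside the coupled pair `(V, V^⊥)`.
[cite: Carlet2020, Prop. 77] -/
theorem stub_frameLock :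
    ∀ (n : ℕ) (a b : (Fin n → Bool) → Bool) (V : Finset (Fin n → Bool)),
    (forrelation a b = 1 ∨ forrelation a b = -1) →
    ((zeroVec ∈ V ∧ ∀ x ∈ V, ∀ y ∈ V, bxor x y ∈ V) ∧ (((V).card : ℝ) ^ 2 = (2 : ℝ) ^ (n)) ∧ (∀ u ∈ V, ∀ v ∈ V, ∀ x, (b x ^^ b (bxor x u) ^^ b (bxor x v) ^^ b (bxor x (bxor u v))) = false)) →
    ((zeroVec ∈ (Finset.univ.filter fun y => ∀ v ∈ V, twist v y = 1) ∧ ∀ x ∈ (Finset.univ.filter fun y => ∀ v ∈ V, twist v y = 1), ∀ y ∈ (Finset.univ.filter fun y => ∀ v ∈ V, twist v y = 1), bxor x y ∈ (Finset.univ.filter fun y => ∀ v ∈ V, twist v y = 1)) ∧ ((((Finset.univ.filter fun y => ∀ v ∈ V, twist v y = 1)).card : ℝ) ^ 2 = (2 : ℝ) ^ (n)) ∧ (∀ u ∈ (Finset.univ.filter fun y => ∀ v ∈ V, twist v y = 1), ∀ v ∈ (Finset.univ.filter fun y => ∀ v ∈ V, twist v y = 1), ∀ x, (a x ^^ a (bxor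 x u) ^^ a (bxor x v) ^^ a (bxor x (bxor u v))) = false)) ∧
    (∀ u ∈ V, ∀ v ∈ V, ∀ w x : Fin n → Bool, ((b x ^^ b (bxor x u) ^^ b (bxor x v) ^^ b (bxor x (bxor u v))) ^^ (b (bxor x w) ^^ b (bxor (bxor x w) u) ^^ b (bxor (bxor x w) v) ^^ b (bxor (bxor x w) (bxor u v)))) = false) ∧
    (∀ u ∈ (Finset.univ.filter fun y => ∀ v ∈ V, twist v y = 1), ∀ v ∈ (Finset.univ.filter fun y => ∀ v ∈ V, twist v y = 1), ∀ w x : Fin n → Bool,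
      ((a x ^^ a (bxor x u) ^^ a (bxor x v) ^^ a (bxor x (bxor u v))) ^^ (a (bxor x w) ^^ a (bxor (bxor x w) u) ^^ a (bxor (bxor x w) v) ^^ a (bxor (bxor x w) (bxor u v)))) = false) := by
  intro n a b V hΦ hV
  obtain ⟨⟨h0, hadd⟩, hcard, hM⟩ := hV
  obtain ⟨hP0, hPadd⟩ := DerivativeWalsh.bxor_mem_perp V
  have hcardP := (DerivativeWalsh.perp_perp_eq_of_sq h0 hadd hcard).2
  -- (i) second differences of `a` along `P = V^⊥` vanish
  have hMa : ∀ u ∈ (Finset.univ.filter fun y => ∀ v ∈ V, twist v y = 1),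
      ∀ v ∈ (Finset.univ.filter fun y => ∀ v ∈ V, twist v y = 1), ∀ x,
        (a x ^^ a (bxor x u) ^^ a (bxor x v) ^^ a (bxor x (bxor u v))) = false := by
    intro u hu v hv x
    obtain ⟨r, hr⟩ := DerivativeWalsh.dual_affine_on_perp_cosets hΦ h0 hadd hcard hM x
    exact d2_eq_false_of_affine a x u v r (hr u hu) (hr v hv) (hr (bxor u v) (hPadd u hu v hv))
  refine ⟨⟨⟨hP0, hPadd⟩, ?_, hMa⟩, ?_, ?_⟩
  · rw [hcardP]; exact hcard
  · -- (ii) third differences of `b` along `V`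
    intro u hu v hv w x
    rw [hM u hu v hv x, hM u hu v hv (bxor x w)]
    rfl
  · -- (iii) third differences of `a` along `P`
    intro u hu v hv w x
    rw [hMa u hu v hv x, hMa u hu v hv (bxor x w)]
    rfl

end Summit.QuantumAdvantage.QuantumAdvantage.Theorems.SignedExactCubicForrelationNotPrBPP

end
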